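import Literature.Geometry.Kaehler.ComplexTorusHodgeGroupProductNoCommonFactor
import Literature.Algebra.Lie.SimpleIdealOfProduct
import HarnessLib

/-!
# `Lie Hg(X₁ × X₂)(ℂ) ≅ Lie Hg(X₁)(ℂ) × Lie Hg(X₂)(ℂ)` iff the Hodge group splits; `Lie Hg(X₁ × X₂)(ℂ)` is semisimple iff both
# factors are; and the THREE-FACTOR splitting `Hg(X₁ × X₂ × X₃) = Hg(X₁) × Hg(X₂) × Hg(X₃)` for pairwise disjoint simple factors

Layer `Literature/Geometry/Kaehler`, namespace `Literature.Geometry.Kaehler.ComplexTorus`; lane `lit-hodgefound` (Track 2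
foundations library), Layer A3/A4; prover seat `lit-hodgefound-p17` (generation 40, self-proposed row g40-#10, sequel of g40-#7/#8
`ComplexTorusHodgeGroupProductLieAlgebraGoursat` / `…NoCommonFactor` and of the Lie lemma g40-#9 `Literature/Algebra/Lie/SimpleIdealOfProduct`
(a simple ideal of `𝔞 × 𝔟` is a simple ideal of a factor)).  THEOREMS ONLY (no definition, no instance, no notation, no named fact;
D-0026 net debt 0).  Dictionary as in g40-#7: `G = Hg(X₁ × X₂)(ℂ)`, `Gᵢ = Hg(Xᵢ)(ℂ)` in `GL` through `toGL`, `Lie G = lieSubalgebraGL G`.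

MOONEN–ZARHIN (held `paper:arxiv-math_9901113`), §3 (3.1): `𝔥𝔤(X₁ × X₂) ≅ 𝔤₁ ⊕ 𝔤₂ ⊕ Γ_φ ⊆ (𝔤₁ ⊕ 𝔤₃) ⊕ (𝔤₂ ⊕ 𝔤₃)` — so
`𝔥𝔤(X₁ × X₂) = 𝔥𝔤(X₁) ⊕ 𝔥𝔤(X₂)` iff `𝔤₃ = 0` iff `Hg(X₁ × X₂) = Hg(X₁) × Hg(X₂)`; §3 Corollary (p0007): «Let `X₁, …, X_n` be […] no two
of which are isogenous. Write `X = X₁ × ⋯ × X_n`. Then `Hg(X) = Hg(X₁) × ⋯ × Hg(X_n)`» (elliptic curves; here the Lie-theoretic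
mechanism for `n = 3`: pairwise disjoint simple factors).  IMAI §2 Proposition (p. 370): «`Hg(E₁ × ⋯ × E_n) = Hg(E₁) × ⋯ × Hg(E_n)`».

## What is proved (arbitrary complex tori unless stated)

* §1 **`isSemisimple_lieSubalgebraGL_hodgeGroupC_prod_iff`** — `Lie Hg(X₁ × X₂)(ℂ)` is semisimple iff `Lie Hg(X₁)(ℂ)` and
  `Lie Hg(X₂)(ℂ)` are (⟸: the radical maps into both radicals under the SURJECTIVE block projections of g40-#7 and `ker r₁ ⊓ ker r₂ = 0`,
  then Cartan's criterion; ⟹: images of a semisimple algebra); the `hodgeGroupComplexLie` form.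
* §2 **`hodgeGroupC_prod_eq_blockDiagProd_iff_nonempty_lieEquiv_prod`** — `Hg(X₁ × X₂)(ℂ) = Hg(X₁)(ℂ) × Hg(X₂)(ℂ)` iff
  `Lie Hg(X₁ × X₂)(ℂ) ≅ Lie Hg(X₁)(ℂ) × Lie Hg(X₂)(ℂ)` as complex Lie algebras (⟹ through `(r₁, r₂)`, Goursat + the dimension criterion;
  ⟸ by dimensions); `nonempty_lieEquiv_hodgeGroupComplexLie_prod_of_hodgeGroupC_prod_eq` (analytic form).
* §3 THREE FACTORS: **`hodgeGroupC_prod_prod_eq_of_forall_isSimple_isEmpty_lieEquiv`** — `Lie Hg(Xᵢ)(ℂ)` semisimple (`i = 1, 2, 3`) with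
  PAIRWISE no common simple factor ⟹ `Hg((X₁ × X₂) × X₃)(ℂ) = (Hg(X₁)(ℂ) × Hg(X₂)(ℂ)) × Hg(X₃)(ℂ)` (§1–§2 + g40-#9: the simple ideals
  of `Lie Hg(X₁)(ℂ) × Lie Hg(X₂)(ℂ)` are those of the factors), and the (D)-transfer to `(X₁ × X₂) × X₃`.

## References

* [MoonenZarhin1999LowDim] B. Moonen, Yu. G. Zarhin, Math. Ann. 315 (1999), §3 (3.1) and Corollary.
* [Imai1976HodgeGroups] H. Imai, *On the Hodge groups of some abelian varieties*, Kodai Math. Sem. Rep. 27 (1976), §2 Proposition.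
* [Gordon1997] B. B. Gordon, *A survey of the Hodge conjecture for abelian varieties* (alg-geom/9709030), §2.16 Proposition, Thm. 7.6.2.
* [Bourbaki1989LieGroups13] N. Bourbaki, *Lie Groups and Lie Algebras*, Ch. I §6 no. 1 Remark 3, no. 2 Lemma 1 (radicals, products).
* [Humphreys1972] J. E. Humphreys, GTM 9, §5.2 Theorem.
-/

noncomputable section

open Matrix Module

namespace Literature.Geometry.Kaehler

namespace ComplexTorus

open Literature.NumberTheory.Automorphic (lieAlgebraGL lieSubalgebraGL)
open Literature.Algebra.Lie

/-! ### A generic radical lemma (file-local) -/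

section Generic

/-- Jointly injective surjections onto Lie algebras with trivial radical force a trivial radical (the image of the radical under a
surjection lies in the radical). [cite: Bourbaki1989LieGroups13, Ch. I §6 no. 2 Cor. 2 of Prop. 2] -/
private theorem hasTrivialRadical_of_surjective_of_ker_inf_eq_bot {K : Type*} [Field K] [CharZero K] {𝔤 𝔞 𝔟 : Type*} [LieRing 𝔤]
    [LieAlgebra K 𝔤] [LieRing 𝔞] [LieAlgebra K 𝔞] [LieRing 𝔟] [LieAlgebra K 𝔟] [Module.Finite K 𝔤] [Module.Finite K 𝔞]
    [Module.Finite K 𝔟] [LieAlgebra.HasTrivialRadical K 𝔞] [LieAlgebra.HasTrivialRadical K 𝔟] (f : 𝔤 →ₗ⁅K⁆ 𝔞) (g : 𝔤 →ₗ⁅K⁆ 𝔟)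
    (hf : Function.Surjective f) (hg : Function.Surjective g) (hker : f.ker ⊓ g.ker = ⊥) :
    LieAlgebra.HasTrivialRadical K 𝔤 := by
  rw [LieAlgebra.hasTrivialRadical_iff]
  have h1 : (LieAlgebra.radical K 𝔤).map f = ⊥ := by
    rw [eq_bot_iff, ← LieAlgebra.HasTrivialRadical.radical_eq_bot (R := K) (L := 𝔞)]
    exact map_radical_le_of_surjective hf
  have h2 : (LieAlgebra.radical K 𝔤).map g = ⊥ := by
    rw [eq_bot_iff, ← LieAlgebra.HasTrivialRadical.radical_eq_bot (R := K) (L := 𝔟)]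
    exact map_radical_le_of_surjective hg
  rw [LieIdeal.map_eq_bot_iff] at h1 h2
  rw [eq_bot_iff, ← hker]
  exact le_inf h1 h2

end Generic

variable {ι₁ ι₂ ι₃ : Type*} [Fintype ι₁] [Fintype ι₂] [Fintype ι₃] [DecidableEq ι₁] [DecidableEq ι₂] [DecidableEq ι₃]
  {E₁ E₂ E₃ : Type*} [NormedAddCommGroup E₁] [NormedSpace ℂ E₁] [NormedAddCommGroup E₂] [NormedSpace ℂ E₂]
  [NormedAddCommGroup E₃] [NormedSpace ℂ E₃]
  (Φ₁ : (ι₁ → ℝ) ≃L[ℝ] E₁) (Φ₂ : (ι₂ → ℝ) ≃L[ℝ] E₂) (Φ₃ : (ι₃ → ℝ) ≃L[ℝ] E₃)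

/-! ### §1 Semisimplicity of `Lie Hg(X₁ × X₂)(ℂ)` -/

/-- **`Lie Hg(X₁)(ℂ)`, `Lie Hg(X₂)(ℂ)` semisimple ⟹ `Lie Hg(X₁ × X₂)(ℂ)` semisimple** (every pair of complex tori): its radical maps
into the radicals of the factors under the surjective block projections (g40-#7), which are jointly injective; then Cartan's
criterion. [cite: MoonenZarhin1999LowDim, §3 (3.1)] [cite: Bourbaki1989LieGroups13, Ch. I §6 no. 2 Lemma 1 and Cor. 2 of Prop. 2] -/
theorem isSemisimple_lieSubalgebraGL_hodgeGroupC_prod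
    [LieAlgebra.IsSemisimple ℂ (lieSubalgebraGL ((hodgeGroupC Φ₁).map Matrix.SpecialLinearGroup.toGL))]
    [LieAlgebra.IsSemisimple ℂ (lieSubalgebraGL ((hodgeGroupC Φ₂).map Matrix.SpecialLinearGroup.toGL))] :
    LieAlgebra.IsSemisimple ℂ (lieSubalgebraGL ((hodgeGroupC (prodPeriod Φ₁ Φ₂)).map Matrix.SpecialLinearGroup.toGL)) := by
  obtain ⟨f, g, -, -, hfs, hgs, hker⟩ := exists_lieHom_toBlocks Φ₁ Φ₂
  haveI : Module.Finite ℂ (lieSubalgebraGL ((hodgeGroupC (prodPeriod Φ₁ Φ₂)).map Matrix.SpecialLinearGroup.toGL)) :=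
    (isZConnected_map_toGL_hodgeGroupC (prodPeriod Φ₁ Φ₂)).finrank_lieAlgebraGL_eq.1
  haveI : Module.Finite ℂ (lieSubalgebraGL ((hodgeGroupC Φ₁).map Matrix.SpecialLinearGroup.toGL)) :=
    (isZConnected_map_toGL_hodgeGroupC Φ₁).finrank_lieAlgebraGL_eq.1
  haveI : Module.Finite ℂ (lieSubalgebraGL ((hodgeGroupC Φ₂).map Matrix.SpecialLinearGroup.toGL)) :=
    (isZConnected_map_toGL_hodgeGroupC Φ₂).finrank_lieAlgebraGL_eq.1
  haveI := hasTrivialRadical_of_surjective_of_ker_inf_eq_bot f g hfs hgs hker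
  haveI := LieAlgebra.HasTrivialRadical.instIsKilling ℂ
    (lieSubalgebraGL ((hodgeGroupC (prodPeriod Φ₁ Φ₂)).map Matrix.SpecialLinearGroup.toGL))
  exact LieAlgebra.IsKilling.instSemisimple ℂ _

/-- **`Lie Hg(X₁ × X₂)(ℂ)` semisimple ⟹ `Lie Hg(X₁)(ℂ)` and `Lie Hg(X₂)(ℂ)` semisimple** (images of a semisimple Lie algebra under the
surjective block projections). [cite: Bourbaki1989LieGroups13, Ch. I §6 no. 2 Lemma 1] [cite: MoonenZarhin1999LowDim, §3 (3.1)] -/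
theorem isSemisimple_lieSubalgebraGL_hodgeGroupC_of_prod
    [LieAlgebra.IsSemisimple ℂ (lieSubalgebraGL ((hodgeGroupC (prodPeriod Φ₁ Φ₂)).map Matrix.SpecialLinearGroup.toGL))] :
    LieAlgebra.IsSemisimple ℂ (lieSubalgebraGL ((hodgeGroupC Φ₁).map Matrix.SpecialLinearGroup.toGL)) ∧
      LieAlgebra.IsSemisimple ℂ (lieSubalgebraGL ((hodgeGroupC Φ₂).map Matrix.SpecialLinearGroup.toGL)) := by
  obtain ⟨f, g, -, -, hfs, hgs, -⟩ := exists_lieHom_toBlocks Φ₁ Φ₂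
  haveI : Module.Finite ℂ (lieSubalgebraGL ((hodgeGroupC (prodPeriod Φ₁ Φ₂)).map Matrix.SpecialLinearGroup.toGL)) :=
    (isZConnected_map_toGL_hodgeGroupC (prodPeriod Φ₁ Φ₂)).finrank_lieAlgebraGL_eq.1
  haveI : Module.Finite ℂ (lieSubalgebraGL ((hodgeGroupC Φ₁).map Matrix.SpecialLinearGroup.toGL)) :=
    (isZConnected_map_toGL_hodgeGroupC Φ₁).finrank_lieAlgebraGL_eq.1
  haveI : Module.Finite ℂ (lieSubalgebraGL ((hodgeGroupC Φ₂).map Matrix.SpecialLinearGroup.toGL)) :=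
    (isZConnected_map_toGL_hodgeGroupC Φ₂).finrank_lieAlgebraGL_eq.1
  exact ⟨isSemisimple_of_surjective f hfs, isSemisimple_of_surjective g hgs⟩

/-- **`Lie Hg(X₁ × X₂)(ℂ)` is semisimple iff `Lie Hg(X₁)(ℂ)` and `Lie Hg(X₂)(ℂ)` are.** [cite: MoonenZarhin1999LowDim, §3 (3.1)]
[cite: Bourbaki1989LieGroups13, Ch. I §6 no. 2 Lemma 1] -/
theorem isSemisimple_lieSubalgebraGL_hodgeGroupC_prod_iff :
    LieAlgebra.IsSemisimple ℂ (lieSubalgebraGL ((hodgeGroupC (prodPeriod Φ₁ Φ₂)).map Matrix.SpecialLinearGroup.toGL)) ↔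
      LieAlgebra.IsSemisimple ℂ (lieSubalgebraGL ((hodgeGroupC Φ₁).map Matrix.SpecialLinearGroup.toGL)) ∧
        LieAlgebra.IsSemisimple ℂ (lieSubalgebraGL ((hodgeGroupC Φ₂).map Matrix.SpecialLinearGroup.toGL)) := by
  constructor
  · intro h
    exact isSemisimple_lieSubalgebraGL_hodgeGroupC_of_prod Φ₁ Φ₂
  · rintro ⟨h₁, h₂⟩
    exact isSemisimple_lieSubalgebraGL_hodgeGroupC_prod Φ₁ Φ₂

/-- Analytic form: `𝔥𝔤_ℂ(X₁ × X₂)` is semisimple iff `𝔥𝔤_ℂ(X₁)` and `𝔥𝔤_ℂ(X₂)` are. [cite: MoonenZarhin1999LowDim, §3 (3.1)] -/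
theorem isSemisimple_hodgeGroupComplexLie_prod_iff :
    LieAlgebra.IsSemisimple ℂ (hodgeGroupComplexLie (prodPeriod Φ₁ Φ₂)) ↔
      LieAlgebra.IsSemisimple ℂ (hodgeGroupComplexLie Φ₁) ∧ LieAlgebra.IsSemisimple ℂ (hodgeGroupComplexLie Φ₂) := by
  rw [hodgeGroupComplexLie_eq_lieSubalgebraGL (prodPeriod Φ₁ Φ₂), hodgeGroupComplexLie_eq_lieSubalgebraGL Φ₁,
    hodgeGroupComplexLie_eq_lieSubalgebraGL Φ₂]
  exact isSemisimple_lieSubalgebraGL_hodgeGroupC_prod_iff Φ₁ Φ₂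

/-! ### §2 Splitting of the group ⟺ splitting of the Lie algebra -/

/-- **`Hg(X₁ × X₂)(ℂ) = Hg(X₁)(ℂ) × Hg(X₂)(ℂ) ⟹ Lie Hg(X₁ × X₂)(ℂ) ≅ Lie Hg(X₁)(ℂ) × Lie Hg(X₂)(ℂ)`** through the block projections
`(r₁, r₂)` (bijective by the dimension criterion and Goursat). [cite: MoonenZarhin1999LowDim, §3 (3.1)] [cite: Gordon1997, §2.16 Proposition] -/
theorem nonempty_lieEquiv_prod_of_hodgeGroupC_prod_eq_blockDiagProd
    (h : hodgeGroupC (prodPeriod Φ₁ Φ₂) = blockDiagProd (hodgeGroupC Φ₁) (hodgeGroupC Φ₂)) :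
    Nonempty (lieSubalgebraGL ((hodgeGroupC (prodPeriod Φ₁ Φ₂)).map Matrix.SpecialLinearGroup.toGL) ≃ₗ⁅ℂ⁆
      (lieSubalgebraGL ((hodgeGroupC Φ₁).map Matrix.SpecialLinearGroup.toGL) ×
        lieSubalgebraGL ((hodgeGroupC Φ₂).map Matrix.SpecialLinearGroup.toGL))) := by
  obtain ⟨f, g, -, -, hfs, hgs, hker⟩ := exists_lieHom_toBlocks Φ₁ Φ₂
  haveI : Module.Finite ℂ (lieSubalgebraGL ((hodgeGroupC (prodPeriod Φ₁ Φ₂)).map Matrix.SpecialLinearGroup.toGL)) :=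
    (isZConnected_map_toGL_hodgeGroupC (prodPeriod Φ₁ Φ₂)).finrank_lieAlgebraGL_eq.1
  haveI : Module.Finite ℂ (lieSubalgebraGL ((hodgeGroupC Φ₁).map Matrix.SpecialLinearGroup.toGL)) :=
    (isZConnected_map_toGL_hodgeGroupC Φ₁).finrank_lieAlgebraGL_eq.1
  have hdim := (hodgeGroupC_prod_eq_blockDiagProd_iff_finrank_lieAlgebraGL_eq_add Φ₁ Φ₂).1 h
  exact ⟨LieEquiv.ofBijective (f.prod g) ((GoursatLemma.finrank_eq_add_iff_bijective_prod f g hfs hgs hker).1 hdim)⟩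

/-- **`Lie Hg(X₁ × X₂)(ℂ) ≅ Lie Hg(X₁)(ℂ) × Lie Hg(X₂)(ℂ)` (any isomorphism) ⟹ `Hg(X₁ × X₂)(ℂ) = Hg(X₁)(ℂ) × Hg(X₂)(ℂ)`** (dimensions).
[cite: MoonenZarhin1999LowDim, §3 (3.1)] -/
theorem hodgeGroupC_prod_eq_blockDiagProd_of_nonempty_lieEquiv_prod
    (h : Nonempty (lieSubalgebraGL ((hodgeGroupC (prodPeriod Φ₁ Φ₂)).map Matrix.SpecialLinearGroup.toGL) ≃ₗ⁅ℂ⁆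
      (lieSubalgebraGL ((hodgeGroupC Φ₁).map Matrix.SpecialLinearGroup.toGL) ×
        lieSubalgebraGL ((hodgeGroupC Φ₂).map Matrix.SpecialLinearGroup.toGL)))) :
    hodgeGroupC (prodPeriod Φ₁ Φ₂) = blockDiagProd (hodgeGroupC Φ₁) (hodgeGroupC Φ₂) := by
  obtain ⟨e⟩ := h
  haveI : Module.Finite ℂ (lieSubalgebraGL ((hodgeGroupC Φ₁).map Matrix.SpecialLinearGroup.toGL)) :=
    (isZConnected_map_toGL_hodgeGroupC Φ₁).finrank_lieAlgebraGL_eq.1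
  haveI : Module.Finite ℂ (lieSubalgebraGL ((hodgeGroupC Φ₂).map Matrix.SpecialLinearGroup.toGL)) :=
    (isZConnected_map_toGL_hodgeGroupC Φ₂).finrank_lieAlgebraGL_eq.1
  refine (hodgeGroupC_prod_eq_blockDiagProd_iff_finrank_lieAlgebraGL_eq_add Φ₁ Φ₂).2 ?_
  have h' := e.toLinearEquiv.finrank_eq
  rw [Module.finrank_prod] at h'
  exact h'

/-- **`Hg(X₁ × X₂)(ℂ) = Hg(X₁)(ℂ) × Hg(X₂)(ℂ) ⟺ Lie Hg(X₁ × X₂)(ℂ) ≅ Lie Hg(X₁)(ℂ) × Lie Hg(X₂)(ℂ)`** ("`𝔤₃ = 0`").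
[cite: MoonenZarhin1999LowDim, §3 (3.1)] [cite: Gordon1997, §2.16 Proposition] -/
theorem hodgeGroupC_prod_eq_blockDiagProd_iff_nonempty_lieEquiv_prod :
    hodgeGroupC (prodPeriod Φ₁ Φ₂) = blockDiagProd (hodgeGroupC Φ₁) (hodgeGroupC Φ₂) ↔
      Nonempty (lieSubalgebraGL ((hodgeGroupC (prodPeriod Φ₁ Φ₂)).map Matrix.SpecialLinearGroup.toGL) ≃ₗ⁅ℂ⁆
        (lieSubalgebraGL ((hodgeGroupC Φ₁).map Matrix.SpecialLinearGroup.toGL) ×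
          lieSubalgebraGL ((hodgeGroupC Φ₂).map Matrix.SpecialLinearGroup.toGL))) :=
  ⟨nonempty_lieEquiv_prod_of_hodgeGroupC_prod_eq_blockDiagProd Φ₁ Φ₂, hodgeGroupC_prod_eq_blockDiagProd_of_nonempty_lieEquiv_prod Φ₁ Φ₂⟩

/-- Analytic form: `Hg(X₁ × X₂)(ℂ) = Hg(X₁)(ℂ) × Hg(X₂)(ℂ) ⟹ 𝔥𝔤_ℂ(X₁ × X₂) ≅ 𝔥𝔤_ℂ(X₁) × 𝔥𝔤_ℂ(X₂)`.
[cite: MoonenZarhin1999LowDim, §3 (3.1)] -/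
theorem nonempty_lieEquiv_hodgeGroupComplexLie_prod_of_hodgeGroupC_prod_eq
    (h : hodgeGroupC (prodPeriod Φ₁ Φ₂) = blockDiagProd (hodgeGroupC Φ₁) (hodgeGroupC Φ₂)) :
    Nonempty (hodgeGroupComplexLie (prodPeriod Φ₁ Φ₂) ≃ₗ⁅ℂ⁆ (hodgeGroupComplexLie Φ₁ × hodgeGroupComplexLie Φ₂)) := by
  rw [hodgeGroupComplexLie_eq_lieSubalgebraGL (prodPeriod Φ₁ Φ₂), hodgeGroupComplexLie_eq_lieSubalgebraGL Φ₁,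
    hodgeGroupComplexLie_eq_lieSubalgebraGL Φ₂]
  exact nonempty_lieEquiv_prod_of_hodgeGroupC_prod_eq_blockDiagProd Φ₁ Φ₂ h

/-! ### §3 Three factors with pairwise disjoint simple factors -/

/-- **THREE FACTORS: `Lie Hg(Xᵢ)(ℂ)` semisimple (`i = 1, 2, 3`) with PAIRWISE NO COMMON SIMPLE FACTOR ⟹
`Hg((X₁ × X₂) × X₃)(ℂ) = (Hg(X₁)(ℂ) × Hg(X₂)(ℂ)) × Hg(X₃)(ℂ)`** — first `Hg(X₁ × X₂)` splits (g40-#7), then `Lie Hg(X₁ × X₂)(ℂ) ≅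
Lie Hg(X₁)(ℂ) × Lie Hg(X₂)(ℂ)` is semisimple (§1) and shares no simple factor with `Lie Hg(X₃)(ℂ)` (its simple ideals are those of the
factors, g40-#9), so the outer product splits. [cite: MoonenZarhin1999LowDim, §3 (3.1) and Corollary] [cite: Imai1976HodgeGroups, §2 Proposition]
[cite: Humphreys1972, §5.2 Theorem] -/
theorem hodgeGroupC_prod_prod_eq_of_forall_isSimple_isEmpty_lieEquiv
    [LieAlgebra.IsSemisimple ℂ (lieSubalgebraGL ((hodgeGroupC Φ₁).map Matrix.SpecialLinearGroup.toGL))]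
    [LieAlgebra.IsSemisimple ℂ (lieSubalgebraGL ((hodgeGroupC Φ₂).map Matrix.SpecialLinearGroup.toGL))]
    [LieAlgebra.IsSemisimple ℂ (lieSubalgebraGL ((hodgeGroupC Φ₃).map Matrix.SpecialLinearGroup.toGL))]
    (h₁₂ : ∀ (A : LieIdeal ℂ (lieSubalgebraGL ((hodgeGroupC Φ₁).map Matrix.SpecialLinearGroup.toGL)))
      (B : LieIdeal ℂ (lieSubalgebraGL ((hodgeGroupC Φ₂).map Matrix.SpecialLinearGroup.toGL))),
      LieAlgebra.IsSimple ℂ A → LieAlgebra.IsSimple ℂ B → IsEmpty (A ≃ₗ⁅ℂ⁆ B))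
    (h₁₃ : ∀ (A : LieIdeal ℂ (lieSubalgebraGL ((hodgeGroupC Φ₁).map Matrix.SpecialLinearGroup.toGL)))
      (C : LieIdeal ℂ (lieSubalgebraGL ((hodgeGroupC Φ₃).map Matrix.SpecialLinearGroup.toGL))),
      LieAlgebra.IsSimple ℂ A → LieAlgebra.IsSimple ℂ C → IsEmpty (A ≃ₗ⁅ℂ⁆ C))
    (h₂₃ : ∀ (B : LieIdeal ℂ (lieSubalgebraGL ((hodgeGroupC Φ₂).map Matrix.SpecialLinearGroup.toGL)))
      (C : LieIdeal ℂ (lieSubalgebraGL ((hodgeGroupC Φ₃).map Matrix.SpecialLinearGroup.toGL))),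
      LieAlgebra.IsSimple ℂ B → LieAlgebra.IsSimple ℂ C → IsEmpty (B ≃ₗ⁅ℂ⁆ C)) :
    hodgeGroupC (prodPeriod Φ₁ Φ₂) = blockDiagProd (hodgeGroupC Φ₁) (hodgeGroupC Φ₂) ∧
      hodgeGroupC (prodPeriod (prodPeriod Φ₁ Φ₂) Φ₃) = blockDiagProd (hodgeGroupC (prodPeriod Φ₁ Φ₂)) (hodgeGroupC Φ₃) := by
  have h12 := hodgeGroupC_prod_eq_blockDiagProd_of_forall_isSimple_isEmpty_lieEquiv Φ₁ Φ₂ h₁₂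
  refine ⟨h12, ?_⟩
  haveI := isSemisimple_lieSubalgebraGL_hodgeGroupC_prod Φ₁ Φ₂
  obtain ⟨e⟩ := nonempty_lieEquiv_prod_of_hodgeGroupC_prod_eq_blockDiagProd Φ₁ Φ₂ h12
  exact hodgeGroupC_prod_eq_blockDiagProd_of_forall_isSimple_isEmpty_lieEquiv (prodPeriod Φ₁ Φ₂) Φ₃
    (SimpleIdealOfProduct.forall_isSimple_isEmpty_lieEquiv_of_lieEquiv_left e
      (SimpleIdealOfProduct.forall_isSimple_isEmpty_lieEquiv_prod_left h₁₃ h₂₃))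

variable {Φ₁ Φ₂ Φ₃} in
/-- **(D)-transfer to three factors**: stably nondegenerate `X₁`, `X₂`, `X₃` whose `Lie Hg(Xᵢ)(ℂ)` are semisimple with pairwise no
common simple factor have a stably nondegenerate product `(X₁ × X₂) × X₃`. [cite: MoonenZarhin1999LowDim, Thm. (3.2)(1) and §3 Corollary]
[cite: Gordon1997, Thm. 7.6.2] -/
theorem forall_divisorClasses_powPeriod_prod_prod_eq_hodgeClasses_of_forall_isSimple_isEmpty_lieEquiv
    [LieAlgebra.IsSemisimple ℂ (lieSubalgebraGL ((hodgeGroupC Φ₁).map Matrix.SpecialLinearGroup.toGL))]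
    [LieAlgebra.IsSemisimple ℂ (lieSubalgebraGL ((hodgeGroupC Φ₂).map Matrix.SpecialLinearGroup.toGL))]
    [LieAlgebra.IsSemisimple ℂ (lieSubalgebraGL ((hodgeGroupC Φ₃).map Matrix.SpecialLinearGroup.toGL))]
    (h₁₂ : ∀ (A : LieIdeal ℂ (lieSubalgebraGL ((hodgeGroupC Φ₁).map Matrix.SpecialLinearGroup.toGL)))
      (B : LieIdeal ℂ (lieSubalgebraGL ((hodgeGroupC Φ₂).map Matrix.SpecialLinearGroup.toGL))),
      LieAlgebra.IsSimple ℂ A → LieAlgebra.IsSimple ℂ B → IsEmpty (A ≃ₗ⁅ℂ⁆ B))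
    (h₁₃ : ∀ (A : LieIdeal ℂ (lieSubalgebraGL ((hodgeGroupC Φ₁).map Matrix.SpecialLinearGroup.toGL)))
      (C : LieIdeal ℂ (lieSubalgebraGL ((hodgeGroupC Φ₃).map Matrix.SpecialLinearGroup.toGL))),
      LieAlgebra.IsSimple ℂ A → LieAlgebra.IsSimple ℂ C → IsEmpty (A ≃ₗ⁅ℂ⁆ C))
    (h₂₃ : ∀ (B : LieIdeal ℂ (lieSubalgebraGL ((hodgeGroupC Φ₂).map Matrix.SpecialLinearGroup.toGL)))
      (C : LieIdeal ℂ (lieSubalgebraGL ((hodgeGroupC Φ₃).map Matrix.SpecialLinearGroup.toGL))),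
      LieAlgebra.IsSimple ℂ B → LieAlgebra.IsSimple ℂ C → IsEmpty (B ≃ₗ⁅ℂ⁆ C))
    (hX₁ : ∀ k p, divisorClasses (powPeriod Φ₁ k) p = hodgeClasses (powPeriod Φ₁ k) p)
    (hX₂ : ∀ k p, divisorClasses (powPeriod Φ₂ k) p = hodgeClasses (powPeriod Φ₂ k) p)
    (hX₃ : ∀ k p, divisorClasses (powPeriod Φ₃ k) p = hodgeClasses (powPeriod Φ₃ k) p) :
    ∀ k p, divisorClasses (powPeriod (prodPeriod (prodPeriod Φ₁ Φ₂) Φ₃) k) p =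
      hodgeClasses (powPeriod (prodPeriod (prodPeriod Φ₁ Φ₂) Φ₃) k) p := by
  obtain ⟨h12, h123⟩ := hodgeGroupC_prod_prod_eq_of_forall_isSimple_isEmpty_lieEquiv Φ₁ Φ₂ Φ₃ h₁₂ h₁₃ h₂₃
  exact forall_divisorClasses_powPeriod_prod_eq_hodgeClasses_of_hodgeGroupC_prod_eq h123
    (forall_divisorClasses_powPeriod_prod_eq_hodgeClasses_of_hodgeGroupC_prod_eq h12 hX₁ hX₂) hX₃

/-- Analytic form of the three-factor splitting: `𝔥𝔤_ℂ(Xᵢ)` semisimple with pairwise no common simple factor ⟹ both `Hg(X₁ × X₂)` and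
`Hg((X₁ × X₂) × X₃)` split. [cite: MoonenZarhin1999LowDim, §3 (3.1) and Corollary] [cite: Imai1976HodgeGroups, §2 Proposition] -/
theorem hodgeGroupC_prod_prod_eq_of_forall_isSimple_isEmpty_lieEquiv_hodgeGroupComplexLie
    [s₁ : LieAlgebra.IsSemisimple ℂ (hodgeGroupComplexLie Φ₁)] [s₂ : LieAlgebra.IsSemisimple ℂ (hodgeGroupComplexLie Φ₂)]
    [s₃ : LieAlgebra.IsSemisimple ℂ (hodgeGroupComplexLie Φ₃)]
    (h₁₂ : ∀ (A : LieIdeal ℂ (hodgeGroupComplexLie Φ₁)) (B : LieIdeal ℂ (hodgeGroupComplexLie Φ₂)),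
      LieAlgebra.IsSimple ℂ A → LieAlgebra.IsSimple ℂ B → IsEmpty (A ≃ₗ⁅ℂ⁆ B))
    (h₁₃ : ∀ (A : LieIdeal ℂ (hodgeGroupComplexLie Φ₁)) (C : LieIdeal ℂ (hodgeGroupComplexLie Φ₃)),
      LieAlgebra.IsSimple ℂ A → LieAlgebra.IsSimple ℂ C → IsEmpty (A ≃ₗ⁅ℂ⁆ C))
    (h₂₃ : ∀ (B : LieIdeal ℂ (hodgeGroupComplexLie Φ₂)) (C : LieIdeal ℂ (hodgeGroupComplexLie Φ₃)),
      LieAlgebra.IsSimple ℂ B → LieAlgebra.IsSimple ℂ C → IsEmpty (B ≃ₗ⁅ℂ⁆ C)) :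
    hodgeGroupC (prodPeriod Φ₁ Φ₂) = blockDiagProd (hodgeGroupC Φ₁) (hodgeGroupC Φ₂) ∧
      hodgeGroupC (prodPeriod (prodPeriod Φ₁ Φ₂) Φ₃) = blockDiagProd (hodgeGroupC (prodPeriod Φ₁ Φ₂)) (hodgeGroupC Φ₃) := by
  rw [hodgeGroupComplexLie_eq_lieSubalgebraGL Φ₁] at s₁ h₁₂ h₁₃
  rw [hodgeGroupComplexLie_eq_lieSubalgebraGL Φ₂] at s₂ h₁₂ h₂₃
  rw [hodgeGroupComplexLie_eq_lieSubalgebraGL Φ₃] at s₃ h₁₃ h₂₃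
  exact hodgeGroupC_prod_prod_eq_of_forall_isSimple_isEmpty_lieEquiv Φ₁ Φ₂ Φ₃ h₁₂ h₁₃ h₂₃

end ComplexTorus

end Literature.Geometry.Kaehler

end
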